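import Summits.HubbardSuperconductivity.HubbardSuperconductivity.Theses.ParentFirstSMA
import Literature.MathematicalPhysics.QuantumLattice.HubbardModelParticleHoleProofs

/-!
# Birth skeleton (BC3) for crux `HoleSingleModeBelowHalfU` — stmt-HubbardSuperconductivity-10769
(route `ParentFirstSMA`, rank 2; sub-problem `HubbardSuperconductivity`)

Planner `planner-skel-stmt-HubbardSuperconductivity-10769-0`, 2026-08-17 (skeleton-register, re-audit bin
REPAIRABLE). Published as `Cruxes/HoleSingleModeBelowHalfU/Lines/birth.lean`.

THE CRUX. For every `U ∈ [12, 24]` (`t = 1`): `∃ ε > 0, L₀` such that for all even `L ≥ L₀` some momentum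
`k` and some normalised one-hole ground state `φ` (sector `N = L² − 1`) of `hubbardTorus 2 L 1 U` satisfy
`0 < Z` and `2f ≤ (U − ε) Z`, where `P = P_k = Σ_x e^{2πik·x/L} c†_{x↓}(1 − n_{x↑})` is the Gutzwiller-projected
re-creation wave, `Z = ‖Pφ‖²` and `f = Re⟨Pφ, [T, P]φ⟩` (`T = hubbardTorus 2 L 1 0`; `f` is the FULL refill first
moment, `f = ⟨Pφ, (H − E(L²−1)) Pφ⟩`, because `[Σ n↑n↓, P] = 0` — landed as `holeWave_commute_doublon`).

THE CUT — "Mott gap × pole dominance" (the spectral anatomy of the refill wave at the coherent momentum;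
refuter crux-attack record EVIDENCE-10769-crux-attack.md: `2f/Z → [(z/2)(U − Δ_c) + d_F(2U + 2η)]/(z/2 + d_F)`).
Decompose `Pφ` along the half-filled ground state `ψ₀`: the POLE `⟨ψ₀, Pφ⟩ ψ₀` refills the hole into the parent
and costs EXACTLY `μ_L := E(L²) − E(L²−1)` per unit weight `w := |⟨ψ₀, Pφ⟩|²`; everything else (magnon
shake-off just above the pole, and the k-flat "virtual sea" — refilling the empty partner of a virtual
doublon–hole pair of the Mott background, ≈ `(U + Δ_c)/2 + O(t)` per unit weight) is the incoherent remainder.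
Against the budget `U/2` per unit weight the pole has SLACK `(U − 2μ_L)/2 · w`, and `U − 2μ_L` is the finite-volume
Mott gap `Δ_c(L) = chargeGap (fermionTorusGraph 2 L) 1 U (L²)` by the even-torus particle–hole identity
`E(L²+1) = E(L²−1) + U` (PROVED: `groundEnergyAt_fermionTorus_particleHole`). Hence the crux is EXACTLY the
conjunction of

* `stub_parentMottGap` — the PARENT MOTT GAP on the window: `∀ U ∈ [12,24] ∃ g > 0 ∃ L₀ ∀ even L ≥ L₀,
  g ≤ Δ_c(L)`. Literally hypothesis (a) of crux #4 `DiluteDWavePairsCondense`, quantified over the window; the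
  famous open problem (d = 2 SU(2) Hubbard model: DattaFernandezFrohlich1999 §1.2/§4, Ueltschi1999 =
  `Literature.Barriers.HubbardSuperconductivity.StrongCouplingCeiling`; Langmann–Lenells arXiv:2501.18141 treat the
  Hartree–Fock gap only). WEAKER than the crux: crux ⟹ this stub by the landed support
  `Theorems.ParentFirstSMA.mottGapFromSingleMode_proof` (`Z(U − Δ_c) ≤ 2f`) and three lines of arithmetic (the
  route's `closes`). Size XL/open. Why it might fail: it does not (believed at every U > 0 in d = 2); the risk is
  hardness, not falsity.
* `stub_poleDominatedRefill` — POLE DOMINANCE ("coherence beats the virtual sea"), the crux's surplus over the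
  gap, SCALE-FREE in the gap: `∀ U ∈ [12,24] ∃ θ > 0 ∃ c > 0 ∃ L₀ ∀ even L ≥ L₀ ∃ k, φ (normalised one-hole GS),
  ψ₀ (normalised half-filled GS)` with, for the refill wave `P = P_k`:
  (i) `0 < Z`; (ii) the pole carries a fixed fraction of the refill weight, `c·Z ≤ w` — this is ONE-HOLE
  COHERENCE, a quasiparticle pole of residue `z_r > 0` uniformly in `L` (`w/L² ≍ z_r/2 ≈ 0.1–0.15`,
  `(Z − w)/L² ≍ z_v ≈ 4.7t²/U²`; at a wrong momentum `w = O(1)` while `Z − w ≍ z_v L²`, so (ii) pins `k` to the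
  quasiparticle momentum); (iii) the refill first moment undershoots the budget `U·Z` by at least the fraction
  `θ` of the pole's slack: `2f ≤ U·Z − θ·(U − 2μ_L)·w`. Anatomy: `2f − U Z = −(U − 2μ_L) w + X` with the
  incoherent excess `X ≈ (Δ_c + c't) z_v L² − (Δ_c − c''J)·(magnon part)`, so (iii) holds with
  `1 − θ ≈ (1 + c't/Δ_c)·2z_v/z_r ≈ 0.4` at `U = 12` (z_r ≈ 0.3, z_v ≈ 0.033, Δ_c ≈ 5–6: doi:10.1103/RevModPhys.66.763,
  doi:10.1103/PhysRevB.62.15480) and ≈ 0.1 at `U = 24`. NOT implied by the gap (needs coherence), does NOT imply the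
  gap (if `Δ_c(L) → 0` the slack vanishes and (iii) says nothing uniform) — hence not the crux: the BC3 probe
  `stub → crux` fails. Size XL/open (2D single-hole quasiparticle residue; QMC/SCBA control only for J/t ≳ 0.3–0.6:
  doi:10.1103/PhysRevB.62.15480, doi:10.1103/PhysRevB.44.317); numerically testable by the K1 census instrument
  (refuter `main.py`, jobs j002228–34) through the DIMENSIONLESS finite-size diagnostics `c_L = w/Z` and
  `θ_L = (U Z − 2f)/((U − 2μ_L) w)` on the 4×4 and 6×6 tori. Why it might fail: the crux's own (i)/(ii) —
  `z_r(L) → 0` (2D hole incoherence) or, at `U = 12`, a pole fraction too thin to pay for the sea.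

Composition `HoleSingleModeBelowHalfU_of : stub_parentMottGap → stub_poleDominatedRefill → HoleSingleModeBelowHalfU`
(hypotheses spelled `__Registered.stub_X`, `rfl`-aliases keyed by the stub names, for the native skeleton audit) is
PROVED below without `sorry`: take `ε := θ·g·c`, `L₀ := max(L₁, L₂, 2)`; at an even `L ≥ L₀` take `(k, φ, ψ₀)` from
the pole stub; the particle–hole identity turns `g ≤ Δ_c(L)` into `g ≤ U − 2μ_L`; then
`2f ≤ U Z − θ (U − 2μ_L) w ≤ U Z − θ g w ≤ U Z − θ g c Z = (U − ε) Z` (`w ≥ c Z ≥ 0`, `θ, g > 0`). It concludes the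
route decl `Summit.HubbardSuperconductivity.HubbardSuperconductivity.Theses.ParentFirstSMA.HoleSingleModeBelowHalfU`
BY NAME; `sorry` occurs only in the two `stub_*` theorems.

WHY THIS CUT (and not "coherence ∃" + "budget ∀"). A budget statement quantified over ALL one-hole ground states
at a coherent momentum is FALSE: superpose two degenerate pocket momenta, `φ = αφ_{q₀} + βφ_{q₁}`; at `k₀ = −q₀` the
pole weight is `|α|² z_r L²/2` but the virtual sea of BOTH components stays, so for small `|α|` the ratio `2f/Z`
tends to the sea value `≈ U + Δ_c > U`. Pole fraction and budget must therefore be asserted of the SAME witness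
`(k, φ, ψ₀)` — stub 2 — and the only remaining external input is the sign and size of the pole slack, i.e. the
Mott gap — stub 1. The line honours the informal attack named in the route header ("coherence beats the virtual
sea") and makes its coupling constant explicit (`ε = θ g c`).

Disproof used: none relevant — `ledger crux ls stmt-HubbardSuperconductivity-10769` showed no workfiles (no
`Disproof.lean`, no landed `Theorems/HoleSingleModeBelowHalfU/Negative/*`) on 2026-08-17; `ledger negatives
--problem HubbardSuperconductivity` lists two refuted statements (CooperPairDMottWalk breathing self-duality,
AposterioriCapRg KLS order openness), neither about the one-hole sector, the Mott gap or refill waves.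
Degenerate audit: `L₀ ≥ 2` is forced in the composition (at `L = 0` the particle–hole bookkeeping `L² − 1 + 1 = L²`
fails); both stubs are `∃ L₀`-eventual, so small tori are unconstrained; `U − 2μ_L < 0` cannot occur under stub 1
(it equals `Δ_c(L) ≥ g`), and stub 2 alone never divides by it.

BC3 audit (planner folder `bc/`, farm `lean check --json`, 2026-08-17): see NOTES.md `## birth-certificate` for the
raw outputs — this file rc 0, errors [], sorries = the two `stub_*` declarations exactly, `#print axioms
HoleSingleModeBelowHalfU_of` ⊆ {propext, Classical.choice, Quot.sound}; probes `bc/stub_*_probe.lean`: for each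
stub `S`, `S → HoleSingleModeBelowHalfU` and `S → _root_.HubbardSuperconductivity` by
`first | exact? | simpa [S] | (unfold S; simpa) | aesop` FAIL (4/4).
-/

-- `Summit.<Summit>.<Problem>`: for the single-conjunct summit the duplicate `HubbardSuperconductivity` is mandated.
set_option linter.dupNamespace false

noncomputable section

namespace Summit.HubbardSuperconductivity.HubbardSuperconductivity.Cruxes.HoleSingleModeBelowHalfU.Birth

open Matrix Literature.MathematicalPhysics.QuantumLattice
open Summit.HubbardSuperconductivity.HubbardSuperconductivity.Theses.ParentFirstSMA
open scoped BigOperators Classical Matrix ComplexConjugate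

/-! ## The two registered stubs (signatures self-contained over `Literature` + Mathlib) -/

/-- **Stub 1 — the parent Mott gap on the window.** For every `U ∈ [12, 24]` the half-filled Hubbard torus
(`t = 1`, even side `L`) has a charge gap `Δ_c(L) = E(L²+1) + E(L²−1) − 2E(L²) ≥ g > 0` uniformly in large even
`L`. Hypothesis (a) of `DiluteDWavePairsCondense`, verbatim, quantified over the window; implied by the crux via
the landed `mottGapFromSingleMode_proof`. The open problem of the insulating parent (DattaFernandezFrohlich1999,
Ueltschi1999, arXiv:2501.18141; barrier `StrongCouplingCeiling`). -/
theorem stub_parentMottGap :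
    open Matrix Literature.MathematicalPhysics.QuantumLattice in
    ∀ U : ℝ, 12 ≤ U → U ≤ 24 → ∃ g : ℝ, 0 < g ∧ ∃ L₀ : ℕ, ∀ L : ℕ, L₀ ≤ L → Even L →
      g ≤ chargeGap (fermionTorusGraph 2 L) 1 U (L ^ 2) := by
  sorry

/-- **Stub 2 — pole-dominated refill ("coherence beats the virtual sea"), scale-free in the gap.** For every
`U ∈ [12, 24]` there are `θ > 0`, `c > 0` such that for all large even `L` some momentum `k`, some normalised
one-hole ground state `φ` and some normalised half-filled ground state `ψ₀` satisfy, for the projected refill wave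
`P = Σ_x e^{2πik·x/L} c†_{x↓}(1 − n_{x↑})` (written as `∀ P, P = … → …` to keep the registered signature free of
`let`): (i) `0 < Z = ‖Pφ‖²`; (ii) POLE FRACTION `c·Z ≤ w`, `w = |⟨ψ₀, Pφ⟩|²` (one-hole quasiparticle coherence,
`z_r > 0` uniformly in `L`); (iii) the refill first moment `f = Re⟨Pφ, [T, P]φ⟩` undershoots the budget `U·Z` by
the fraction `θ` of the pole's slack, `2f ≤ U Z − θ (U − 2μ_L) w`, `μ_L = E(L²) − E(L²−1)` the pole's exact refill
energy. Sources: doi:10.1103/PhysRev.94.262 (single-mode anatomy), doi:10.1103/RevModPhys.66.763 §IV and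
doi:10.1103/PhysRevB.62.15480 (z_r ≈ 0.3, ⟨n↑n↓⟩ ≈ 4.7t²/U²), doi:10.1103/PhysRevB.44.317. -/
theorem stub_poleDominatedRefill :
    open Matrix Literature.MathematicalPhysics.QuantumLattice in
    ∀ U : ℝ, 12 ≤ U → U ≤ 24 → ∃ θ : ℝ, 0 < θ ∧ ∃ c : ℝ, 0 < c ∧ ∃ L₀ : ℕ, ∀ L : ℕ, L₀ ≤ L → Even L →
      ∃ (k : Fin 2 → Fin L) (φ ψ₀ : Fock (Orb (FermionTorus 2 L))),
        IsGroundState (hubbardTorus 2 L 1 U) (L ^ 2 - 1) φ ∧ star φ ⬝ᵥ φ = 1 ∧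
        IsGroundState (hubbardTorus 2 L 1 U) (L ^ 2) ψ₀ ∧ star ψ₀ ⬝ᵥ ψ₀ = 1 ∧
        ∀ P : Matrix (Finset (Orb (FermionTorus 2 L))) (Finset (Orb (FermionTorus 2 L))) ℂ,
          P = ∑ x : FermionTorus 2 L, Complex.exp (2 * Real.pi * Complex.I *
              (∑ i : Fin 2, ((ofLex x i : ℕ) : ℂ) * ((k i : ℕ) : ℂ)) / (L : ℂ)) •
                (creation (orb x 1) * (1 - numberOp x 0)) →
          0 < (star (P *ᵥ φ) ⬝ᵥ (P *ᵥ φ)).re ∧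
          c * (star (P *ᵥ φ) ⬝ᵥ (P *ᵥ φ)).re ≤ ‖star ψ₀ ⬝ᵥ (P *ᵥ φ)‖ ^ 2 ∧
          2 * (star (P *ᵥ φ) ⬝ᵥ ((hubbardTorus 2 L 1 0 * P - P * hubbardTorus 2 L 1 0) *ᵥ φ)).re ≤
            U * (star (P *ᵥ φ) ⬝ᵥ (P *ᵥ φ)).re -
              θ * (U - 2 * (groundEnergyAt (fermionTorusGraph 2 L) 1 U (L ^ 2) -
                groundEnergyAt (fermionTorusGraph 2 L) 1 U (L ^ 2 - 1))) *
                  ‖star ψ₀ ⬝ᵥ (P *ᵥ φ)‖ ^ 2 := by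
  sorry

/-! ## Name-keyed aliases of the two stub statements — the hypotheses of `HoleSingleModeBelowHalfU_of`

The native skeleton audit (`#h21_check_skeleton`) admits a `Prop` hypothesis of the skeleton theorem only if its
head constant is a registered obligation or is NAMED like a declared stub; `__Registered.stub_X` is the statement
of `stub_X` under that name (device of `AtomisticToContinuum/BoseEinsteinCondensation/Cruxes/AmplitudeLDP/Lines/
birth.lean`). Each alias is the stub's statement verbatim; the wiring `example` at the end checks they agree. -/
namespace __Registered

/-- Alias of the statement of `stub_parentMottGap`, keyed by the registered stub name. -/
abbrev stub_parentMottGap : Prop :=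
  open Matrix Literature.MathematicalPhysics.QuantumLattice in
  ∀ U : ℝ, 12 ≤ U → U ≤ 24 → ∃ g : ℝ, 0 < g ∧ ∃ L₀ : ℕ, ∀ L : ℕ, L₀ ≤ L → Even L →
    g ≤ chargeGap (fermionTorusGraph 2 L) 1 U (L ^ 2)

/-- Alias of the statement of `stub_poleDominatedRefill`, keyed by the registered stub name. -/
abbrev stub_poleDominatedRefill : Prop :=
  open Matrix Literature.MathematicalPhysics.QuantumLattice in
  ∀ U : ℝ, 12 ≤ U → U ≤ 24 → ∃ θ : ℝ, 0 < θ ∧ ∃ c : ℝ, 0 < c ∧ ∃ L₀ : ℕ, ∀ L : ℕ, L₀ ≤ L → Even L →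
    ∃ (k : Fin 2 → Fin L) (φ ψ₀ : Fock (Orb (FermionTorus 2 L))),
      IsGroundState (hubbardTorus 2 L 1 U) (L ^ 2 - 1) φ ∧ star φ ⬝ᵥ φ = 1 ∧
      IsGroundState (hubbardTorus 2 L 1 U) (L ^ 2) ψ₀ ∧ star ψ₀ ⬝ᵥ ψ₀ = 1 ∧
      ∀ P : Matrix (Finset (Orb (FermionTorus 2 L))) (Finset (Orb (FermionTorus 2 L))) ℂ,
        P = ∑ x : FermionTorus 2 L, Complex.exp (2 * Real.pi * Complex.I *
            (∑ i : Fin 2, ((ofLex x i : ℕ) : ℂ) * ((k i : ℕ) : ℂ)) / (L : ℂ)) •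
              (creation (orb x 1) * (1 - numberOp x 0)) →
        0 < (star (P *ᵥ φ) ⬝ᵥ (P *ᵥ φ)).re ∧
        c * (star (P *ᵥ φ) ⬝ᵥ (P *ᵥ φ)).re ≤ ‖star ψ₀ ⬝ᵥ (P *ᵥ φ)‖ ^ 2 ∧
        2 * (star (P *ᵥ φ) ⬝ᵥ ((hubbardTorus 2 L 1 0 * P - P * hubbardTorus 2 L 1 0) *ᵥ φ)).re ≤
          U * (star (P *ᵥ φ) ⬝ᵥ (P *ᵥ φ)).re -
            θ * (U - 2 * (groundEnergyAt (fermionTorusGraph 2 L) 1 U (L ^ 2) -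
              groundEnergyAt (fermionTorusGraph 2 L) 1 U (L ^ 2 - 1))) *
                ‖star ψ₀ ⬝ᵥ (P *ᵥ φ)‖ ^ 2

end __Registered

/-! ## Sorry-free infrastructure -/

/-- The real-arithmetic heart of the composition: pole fraction `c Z ≤ w`, budget `2f ≤ U Z − θ (U − 2μ) w`,
particle–hole bookkeeping `Δ = U − 2μ` and the gap `g ≤ Δ` give `2f ≤ (U − θ g c) Z`. [folklore] -/
theorem refill_budget_of_pole {U θ g c Z w f μ Δ : ℝ} (hθ : 0 < θ) (hg : 0 < g) (hc : 0 < c)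
    (hZ : 0 < Z) (hcw : c * Z ≤ w) (hf : 2 * f ≤ U * Z - θ * (U - 2 * μ) * w) (hΔ : Δ = U - 2 * μ)
    (hgap : g ≤ Δ) : 2 * f ≤ (U - θ * g * c) * Z := by
  have hw : 0 ≤ w := le_trans (mul_pos hc hZ).le hcw
  have h1 : g * w ≤ (U - 2 * μ) * w := mul_le_mul_of_nonneg_right (hΔ ▸ hgap) hw
  have h2 : θ * (g * w) ≤ θ * ((U - 2 * μ) * w) := mul_le_mul_of_nonneg_left h1 hθ.le
  have h3 : θ * g * (c * Z) ≤ θ * g * w := mul_le_mul_of_nonneg_left hcw (mul_pos hθ hg).le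
  nlinarith [h2, h3]

/-- Particle–hole bookkeeping on the even torus: for even `L ≥ 2` the Lieb–Wu charge gap at half filling is the
pole's slack, `Δ_c(L) = U − 2 (E(L²) − E(L² − 1))`, from the PROVED identity `E(L² − 1) = E(L² + 1) − U`
(`groundEnergyAt_fermionTorus_particleHole`). [cite: LiebWuPhysicaA2003, §1 eq. (3)] -/
theorem chargeGap_eq_slack (U : ℝ) {L : ℕ} (hLe : Even L) (h2 : 2 ≤ L) :
    chargeGap (fermionTorusGraph 2 L) 1 U (L ^ 2) =
      U - 2 * (groundEnergyAt (fermionTorusGraph 2 L) 1 U (L ^ 2) -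
        groundEnergyAt (fermionTorusGraph 2 L) 1 U (L ^ 2 - 1)) := by
  have hL1 : 1 ≤ L ^ 2 := Nat.one_le_pow _ _ (by omega)
  have hph := groundEnergyAt_fermionTorus_particleHole (d := 2) hLe 1 U (N := L ^ 2 - 1) (by omega)
  have hK : 2 * L ^ 2 - (L ^ 2 - 1) = L ^ 2 + 1 := by
    generalize L ^ 2 = K at hL1 ⊢
    omega
  rw [hK] at hph
  have hcast : ((L : ℝ) ^ 2 - ((L ^ 2 - 1 : ℕ) : ℝ)) = 1 := by
    rw [Nat.cast_sub hL1]
    push_cast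
    ring
  rw [hcast, one_mul] at hph
  unfold chargeGap
  linarith [hph]

/-! ## Composition: the crux BY NAME from the two stub statements (no `sorry` below) -/

/-- **HoleSingleModeBelowHalfU_of** — Mott gap (stub 1) × pole dominance (stub 2) ⟹ the crux, with
`ε := θ·g·c` and `L₀ := max (max L₁ L₂) 2`: at an even `L ≥ L₀` take `(k, φ, ψ₀)` from stub 2, turn `g ≤ Δ_c(L)`
into `g ≤ U − 2μ_L` by `chargeGap_eq_slack`, and run `refill_budget_of_pole`. Hypotheses = the two stub
statements under their registered names (`__Registered.stub_X`); conclusion = the route decl, by name. -/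
theorem HoleSingleModeBelowHalfU_of (hgap : __Registered.stub_parentMottGap)
    (hpole : __Registered.stub_poleDominatedRefill) :
    Summit.HubbardSuperconductivity.HubbardSuperconductivity.Theses.ParentFirstSMA.HoleSingleModeBelowHalfU := by
  intro U hU12 hU24
  obtain ⟨g, hg, L₁, hG⟩ := hgap U hU12 hU24
  obtain ⟨θ, hθ, c, hc, L₂, hP⟩ := hpole U hU12 hU24
  refine ⟨θ * g * c, by positivity, max (max L₁ L₂) 2, fun L hL hLe => ?_⟩
  have hL₁ : L₁ ≤ L := le_trans (le_trans (le_max_left _ _) (le_max_left _ _)) hL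
  have hL₂ : L₂ ≤ L := le_trans (le_trans (le_max_right _ _) (le_max_left _ _)) hL
  have h2 : 2 ≤ L := le_trans (le_max_right _ _) hL
  obtain ⟨k, φ, ψ₀, hgs, hnorm, -, -, hbody⟩ := hP L hL₂ hLe
  obtain ⟨hZ, hcw, hf⟩ := hbody _ rfl
  have hΔ := chargeGap_eq_slack U hLe h2
  have hgapL : g ≤ chargeGap (fermionTorusGraph 2 L) 1 U (L ^ 2) := hG L hL₁ hLe
  refine ⟨k, φ, hgs, hnorm, ?_⟩
  dsimp only
  exact ⟨hZ, refill_budget_of_pole hθ hg hc hZ hcw hf hΔ hgapL⟩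

/-- Wiring check (an `example`, so that `HoleSingleModeBelowHalfU_of` stays the only theorem concluding the crux):
the registered stubs feed the skeleton theorem as stated — this term becomes the crux proof when the two `sorry`s
above are discharged (it carries `sorryAx` exactly through the two `stub_*`). -/
example : Summit.HubbardSuperconductivity.HubbardSuperconductivity.Theses.ParentFirstSMA.HoleSingleModeBelowHalfU :=
  HoleSingleModeBelowHalfU_of stub_parentMottGap stub_poleDominatedRefill

end Summit.HubbardSuperconductivity.HubbardSuperconductivity.Cruxes.HoleSingleModeBelowHalfU.Birth

end
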